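import Literature.MathematicalPhysics.QuantumFieldTheory.Balaban1983to89.B9Eq375GradLetters
import Literature.MathematicalPhysics.QuantumFieldTheory.Balaban1983to89.B9Eq375Locality

/-!
# `Balaban1983to89.B9Eq372RemLetters` — B9 p. 405 (3.72) «The operator F_{1,k} … is a local, bounded operator satisfying the bound
# |(F_{1,k}(A)A′)_μ(x)| ≦ O(1)|A|²|A′| ≦ O(1)α₁²(Lʲη)⁻²|A′|» and «the operators F_{2,k}(A), V₂(A) satisfy (3.72), (3.73)
# correspondingly»: THE HIGHER-ORDER OPERATORS `F_{1,k}(A)`, `F_{2,k}(A)` AS ℝ-LINEAR LETTERS ON THE BOND CARRIER with the (3.72)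
# size as ZEROTH-ORDER block majorants, and the FULL `V₁(A)`, `V₂(A)` of (3.71)/(3.75) as operators in gradient form with the
# identities `D*D_{U′U} = D*D_U − V₁(A)`, `DD*_{U′U} = DD*_U − V₂(A)` AS EQUALITIES OF LETTERS (the `h371`-shape of the G-side
# devices) — third file of the G-side twin (`B9Eq371GradLetters`, `B9Eq375GradLetters`)

statement-level skeleton of published theorems with citation tags; proofs where landed; nothing here is a claim about the Yang–Mills mass gap

CITATION HEADER (lean-in-tree rule).  T. Bałaban, *Propagators for lattice gauge theories in a background field*, Commun.
Math. Phys. **99** (1985) 389–434 [Balaban1985BackgroundPropagators] (cell paper B9; held `paper:balaban1985-cmp99-background-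
propagators`, journal page = PDF page + 388).  PDF held: p. 405 [PDF 17] read by this seat on the render `b2b-balaban-ref1/pages/
…-p017-x2.png` (2026-08-21).  THE PRINT (verbatim, p. 405): «The operator F_{1,k} is defined similarly to F′_{1,k} by taking the
remainder of the expansion R(U′) = exp ηiad_A = 1 + ηiad_A + ⋯ in the expressions above. It is a local, bounded operator satisfying
the bound |(F_{1,k}(A)A′)_μ(x)| ≦ O(1)|A|²|A′| ≦ O(1)α₁²(Lʲη)⁻²|A′|, b ∈ Ω_j (3.72) with the same norms |A|, |A′| determined by the set
st(b) as in (3.69).»; «… = (DD\*A′)_μ(x) − (V₂(A)A′)_μ(x), (3.75) and the operators F_{2,k}(A), V₂(A) satisfy (3.72), (3.73)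
correspondingly.»; (3.71) p. 405: «= (D\*DA′)_μ(x) − (V₁(A)A′)_μ(x). (3.71)»; (3.37) p. 396: «|A′| < α₁(Lʲη)⁻¹ … on Ω_j».  [4] =
T. Bałaban, *Propagators and renormalization transformations for lattice gauge theories. II*, Commun. Math. Phys. **96** (1984)
223–250 [Balaban1984PropagatorsII], (2.51)–(2.52) p. 232.  Cell `lit-balaban`, seat r06 (B9 fold owner) gen 10; SKELETON rows
**B9.Eq3.71** ((3.72) is inside the row's range) × **B9.Eq3.74** × B9.Eq3.85 × B9.Thm3.4.

SIBLINGS REUSED BY NAME (imported; nothing restated): pv27's `B9Eq371Composition.F₁op`/`V₁op`/`lapDD`, `B9Eq375Composition.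
F₂op`/`V₂op`/`gradDiv`, their ℂ-LINEAR PACKAGING `B9Eq372Operator.F₁lin`/`V₁lin`/`lapDDlin`/`F₂lin`/`V₂lin`/`gradDivlin` with (3.71)/(3.75)
as `End_ℂ` identities `lapDDlin_prodCfg`/`gradDivlin_prodCfg`, the LOCAL (3.72) bounds `B9Eq372Locality.norm_F₁op_le_st` (letters on
`stBonds(b)` only) and `B9Eq375Locality.norm_F₂op_le_loc` (letters on `locBondsA(b)`/`locBondsA′(b)` only); this seat's `B9Eq371GradLetters`
(`bT`, `bU`, `zeroLetter`, `V1Letter`, `V₁brkOp`, `sum_sBracket_eq`, `hasMajorant_zeroLetter`, `conj_V₁brkOp_eq_gradForm`) and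
`B9Eq375GradLetters` (the `₂` twins); gen 8's `B9Eq352GradLetters.diffLetter`, seam lemma `B9Eq352DivFormLetters.hasMajorant_conj_of_local`.

WHAT THIS FILE PROVES (0 sorry; defs with bodies + theorems; no `def … : Prop`).
* §1 `growth s := e^{2s}(3 + 2s + s²e^{2s})` (pv27's `O(1)` profile of (3.72)), monotone on `s ≧ 0` (`growth_mono`).
* §2 `bondCarrierEnd L : Module.End ℝ (κ × S → 𝔸)` — THE BOND READING of a ℂ-linear operator `L` on vector fields `κ → S → 𝔸` (pv27's
  carrier) as an ℝ-linear letter on the bond carrier `κ × S` of the companions (`A′ ↦ ((μ,x) ↦ (LA′)_μ(x))`; `bondCarrierEnd_apply` rfl,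
  `bondCarrierEnd_add/sub/smul_apply`) — the one device that lets pv27's packaged operators enter gen 8's `conj b`/block-majorant calculus.
* §3 `F₁Letter η A := bondCarrierEnd (η⁻²·F₁lin η A)`, `F₂Letter η A := bondCarrierEnd (η⁻²·F₂lin η A)` — `F_{1,k}(A)`, `F_{2,k}(A)` in TRUE UNITS (pv27
  types them ×η²); `lapDDLetter c V := bondCarrierEnd (c²·lapDDlin V)`, `gradDivLetter c V` — `D*_VD_V`, `D_VD*_V` for ANY configuration `V` in
  the slot of `U`; `V₁Op η A := V₁brkOp η⁻¹ A + F₁Letter η A`, `V₂Op η A := V₂brkOp η⁻¹ A + F₂Letter η A` — THE FULL `V₁(A)`, `V₂(A)` IN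
  GRADIENT FORM, with **`bondCarrierEnd_V₁lin`**: `bondCarrierEnd (η⁻²·V₁lin η A) = V₁Op η A` (pv27's `V₁(A)` read on bonds IS the gradient form + the
  remainder — by `sum_sBracket_eq`), `bondCarrierEnd_V₂lin`, `V₁Op_apply`/`V₂Op_apply` (`η²·(V_iOp A)(A′)(μ,x) = V_iop … A′ μ x`).
* §4 **`lapDDLetter_prodCfg`**: `lapDDLetter η⁻¹ (U′U) = lapDDLetter η⁻¹ U − V₁Op η A` and **`gradDivLetter_prodCfg`** — (3.71)/(3.75) AS
  EQUALITIES OF ℝ-LINEAR LETTERS on the bond carrier (`U′U = prodCfg U η A`; from pv27's `lapDDlin_prodCfg`/`gradDivlin_prodCfg`), and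
  after real coordinates **`conj_lapDDLetter_prodCfg`** / **`conj_gradDivLetter_prodCfg`** — literally the hypothesis shape `h371 :
  DsD′ = DsD − V₁` of `B9Ineq386CommSum.thm34_G_entries13_opForm_of_comm_sum` (and its `DD*` twin); **`conj_V₁Op_eq_gradForm`** /
  **`conj_V₂Op_eq_gradForm`**: `conj b (V_iOp) = conj b (V⁰-part) + Σ_{k∈κ⊕κ} conj b (V¹_k)·conj b (∇_k)` — the `hV₃` shape.
* §5 **`hasMajorant_F₁Letter`**, **`hasMajorant_F₂Letter`** — the (3.72) size as a ZEROTH-ORDER block majorant after real coordinates: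
  under (3.37) read on the stencil of the output bond at the scale of its block (`‖A(b′)‖ ≦ α₁(Lʲη)⁻¹` for `b′ ∈ st(b)` resp. the
  (3.75)-stencil, `b ∈ B(y)`, `y ∈ Λ_j`), transports `1 ≦ ρ`, `‖U‖, ‖U⁻¹‖ ≦ ρ`, the smallness `η·α₁(Lʲη)⁻¹ ≦ 1/4` (so that pv27's `s =
  ηρ²α₁(Lʲη)⁻¹ ≦ ρ²/4`) and the stencil geometry: `conj b (F₁Letter) ≺ (8d·ρ⁸·growth(ρ²/4)·α₁·M₂(Σ‖b_i‖)e^{δd₀})·α₁·(Lʲη)⁻²·e^{−δd}` and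
  `conj b (F₂Letter) ≺ (4d·ρ⁸·growth(ρ²/4)·α₁·M₂(Σ‖b_i‖)e^{δd₀})·α₁·(Lʲη)⁻²·e^{−δd}` — `O(1)α₁²(Lʲη)⁻²` with every O(1) explicit
  (`remainder_bound`: `η⁻²·ρ⁴s²·growth(s) ≦ ρ⁸growth(ρ²/4)·(α₁(Lʲη)⁻¹)²`); **`hasMajorant_V₁Op_zero`**: the zeroth-order part
  `zeroLetter η⁻¹ A + F₁Letter η A` of the full `V₁(A)` has the (3.73) size `O(1)α₁(Lʲη)⁻²` (= the `hV0` input for the `V₁`-third).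

HONEST SCOPE / NOT CLAIMED.  (i) With this file `V₁(A)` and `V₂(A)` are letter-complete in gradient form (`V₁Op`, `V₂Op` +
the majorants of the three files); the curvature difference `Δ′(U′U) − Δ′(U)` of (3.82) and the assembly of `V₃` into the G-side
devices, as well as the commutator letters for the right entry, remain (successor files).  (ii) The stencil hypotheses are stated with
pv27's letter sets `B9Eq372Locality.stBonds` (for `F₁`: the bonds of `st(b)`) and `B9Eq375Locality.locBondsA`/`locBondsA'` (for `F₂`,
which is NOT `st(b)`-local — `B9Eq375Locality.V₂op_not_stLocal`), at the scale of the OUTPUT bond's block (the print's «b ∈ Ω_j»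
convention); the block distances of those stencils are hypotheses (`≦ d₀`, and `d(y,y) ≦ d₀`).  (iii) `|κ| − 1 ≦ |κ|` in the `F₁`
constant (pv27's sharper `d − 1` dropped).  (iv) Operator (block-majorant) form, real coordinates `(κ × S) × ι`, abstract carrier as in
the companions.  Value = the (3.72) remainders and the (3.71)/(3.75) operator identities in the exact shapes the devices consume; NOT
summit progress.

RELATED IN THE TREE, NOT DUPLICATED (searched 2026-08-21: `lean search --decl 'F₁Letter|F₂Letter|lapDDLetter|gradDivLetter|V₁Op\b|V₂Op\b'` = ∅;
the short names `bondEnd` (`B13Lemma3Window`: the END POINT of a lattice bond) and `bondLetter` (`Beta.PlaquetteBackground`) exist with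
unrelated meanings — hence the name `bondCarrierEnd` here; pv27's `B9Eq372Operator.lapDDlin_prodCfg`/`gradDivlin_prodCfg` ARE (3.71)/(3.75) as identities of ℂ-linear maps on `ι → S → 𝔸`
without the `η`-normalisation — USED here through `bondCarrierEnd`, not re-derived; pv27's `opNorm_F₁L_le`/`CF` are sup-NORM bounds with GLOBAL
`|A|`, whereas the devices need BLOCK majorants with the blockwise (3.37) — hence §5 from the LOCAL `norm_F₁op_le_st`/`norm_F₂op_le_loc`).
-/

noncomputable section

namespace Literature.MathematicalPhysics.QuantumFieldTheory.Balaban1983to89.B9Eq372RemLetters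

open NormedSpace Complex
open Literature.MathematicalPhysics.QuantumFieldTheory.Balaban1983to89
open Literature.MathematicalPhysics.QuantumFieldTheory.Balaban1983to89.B6RandomWalk (HasMajorant hasMajorant_mono hasMajorant_add)
open Literature.MathematicalPhysics.QuantumFieldTheory.Balaban1983to89.B9Thm34Ext (toB6)
open Literature.MathematicalPhysics.QuantumFieldTheory.Balaban1983to89.B9Eq39Adjoint
open Literature.MathematicalPhysics.QuantumFieldTheory.Balaban1983to89.B9Eq371Composition (lapDD F₁op V₁op)
open Literature.MathematicalPhysics.QuantumFieldTheory.Balaban1983to89.B9Eq375Composition (gradDiv F₂op V₂op)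
open Literature.MathematicalPhysics.QuantumFieldTheory.Balaban1983to89.B9Eq372Operator (lapDDlin gradDivlin F₁lin V₁lin F₂lin
  V₂lin lapDDlin_apply gradDivlin_apply F₁lin_apply V₁lin_apply F₂lin_apply V₂lin_apply lapDDlin_prodCfg gradDivlin_prodCfg)
open Literature.MathematicalPhysics.QuantumFieldTheory.Balaban1983to89.B9Eq372Locality (stBonds norm_F₁op_le_st)
open Literature.MathematicalPhysics.QuantumFieldTheory.Balaban1983to89.B9Eq375Locality (locBondsA locBondsA' norm_F₂op_le_loc)
open Literature.MathematicalPhysics.QuantumFieldTheory.Balaban1983to89.B9Eq352DivFormLetters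
open Literature.MathematicalPhysics.QuantumFieldTheory.Balaban1983to89.B9Eq352GradLetters (diffLetter conj_add)
open Literature.MathematicalPhysics.QuantumFieldTheory.Balaban1983to89.B9Eq371GradLetters (bT bU zeroLetter V1Letter V₁brkOp
  sum_sBracket_eq hasMajorant_zeroLetter conj_V₁brkOp_eq_gradForm)
open Literature.MathematicalPhysics.QuantumFieldTheory.Balaban1983to89.B9Eq375GradLetters (zeroLetter₂ V1Letter₂ V₂brkOp
  sum_sBracket₂_eq hasMajorant_zeroLetter₂ conj_V₂brkOp_eq_gradForm)

/-! ## §1  The `O(1)` profile of (3.72) -/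

section Growth

/-- pv27's constant profile of (3.72): `growth s = e^{2s}(3 + 2s + s²e^{2s})` (the `O(1)` of «|(F_{1,k}(A)A′)_μ(x)| ≦ O(1)|A|²|A′|» as
`B9Eq372Locality.norm_F₁op_le_st` prints it, at `s = ηρ²|A|`). [cite: Balaban1985BackgroundPropagators, (3.72) p.405] -/
def growth (s : ℝ) : ℝ := Real.exp (2 * s) * (3 + 2 * s + s ^ 2 * Real.exp (2 * s))

/-- `growth` is monotone on `s ≧ 0` (the profile is evaluated at the located bound `s ≦ ρ²/4`).
[cite: Balaban1985BackgroundPropagators, (3.72) p.405] -/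
theorem growth_mono {s t : ℝ} (hs : 0 ≤ s) (hst : s ≤ t) : growth s ≤ growth t := by
  unfold growth
  have h1 : Real.exp (2 * s) ≤ Real.exp (2 * t) := Real.exp_le_exp.mpr (by linarith)
  have h2 : s ^ 2 ≤ t ^ 2 := pow_le_pow_left₀ hs hst 2
  have h3 : 3 + 2 * s + s ^ 2 * Real.exp (2 * s) ≤ 3 + 2 * t + t ^ 2 * Real.exp (2 * t) := by
    have := mul_le_mul h2 h1 (Real.exp_nonneg _) (sq_nonneg t)
    linarith
  exact mul_le_mul h1 h3 (by positivity) (Real.exp_nonneg _)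

/-- `growth s ≧ 0` for `s ≧ 0`. [cite: Balaban1985BackgroundPropagators, (3.72) p.405] -/
theorem growth_nonneg {s : ℝ} (hs : 0 ≤ s) : 0 ≤ growth s := by
  unfold growth; positivity

end Growth

/-! ## §2  Reading pv27's ℂ-linear operators on `κ → S → 𝔸` as ℝ-linear letters on the bond carrier `κ × S` -/

section Bond

variable {𝔸 : Type*} [NormedRing 𝔸] [NormedAlgebra ℂ 𝔸] {S : Type} {κ : Type}

/-- **THE BOND READING**: a ℂ-linear operator `L` on vector fields `κ → S → 𝔸` (pv27's packaging `B9Eq372Operator.F₁lin`, …) read as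
an ℝ-linear letter on the bond carrier `κ × S → 𝔸` of `B9Eq371GradLetters` (`A′ ↦ ((μ,x) ↦ (L A′)_μ(x))`), so that gen 8's real
coordinates `conj b` and the block-majorant calculus apply. [cite: Balaban1985BackgroundPropagators, (3.71)–(3.72) p.404–405] -/
def bondCarrierEnd (L : (κ → S → 𝔸) →ₗ[ℂ] (κ → S → 𝔸)) : Module.End ℝ (κ × S → 𝔸) where
  toFun F := fun p => L (fun k z => F (k, z)) p.1 p.2
  map_add' F F' := by
    funext p
    dsimp only [Pi.add_apply]
    have h : (fun k z => F (k, z) + F' (k, z)) = (fun k z => F (k, z)) + fun k z => F' (k, z) := rfl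
    rw [h, map_add, Pi.add_apply, Pi.add_apply]
  map_smul' r F := by
    funext p
    dsimp only [Pi.smul_apply, RingHom.id_apply]
    have h : (fun k z => r • F (k, z)) = (r : ℂ) • fun k z => F (k, z) := by
      funext k z; exact (Complex.coe_smul r (F (k, z))).symm
    rw [h, map_smul, Pi.smul_apply, Pi.smul_apply, Complex.coe_smul]

/-- Unfolding `bondCarrierEnd`. [cite: Balaban1985BackgroundPropagators, (3.71) p.404] -/
theorem bondCarrierEnd_apply (L : (κ → S → 𝔸) →ₗ[ℂ] (κ → S → 𝔸)) (F : κ × S → 𝔸) (p : κ × S) :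
    bondCarrierEnd L F p = L (fun k z => F (k, z)) p.1 p.2 := rfl

/-- The bond reading is additive. [cite: Balaban1985BackgroundPropagators, (3.71) p.404] -/
theorem bondCarrierEnd_add (L L' : (κ → S → 𝔸) →ₗ[ℂ] (κ → S → 𝔸)) : bondCarrierEnd (L + L') = bondCarrierEnd L + bondCarrierEnd L' := by
  ext F p; rfl

/-- … and respects differences. [cite: Balaban1985BackgroundPropagators, (3.71) p.404] -/
theorem bondCarrierEnd_sub (L L' : (κ → S → 𝔸) →ₗ[ℂ] (κ → S → 𝔸)) : bondCarrierEnd (L - L') = bondCarrierEnd L - bondCarrierEnd L' := by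
  ext F p; rfl

/-- … and complex multiples pass to the values. [cite: Balaban1985BackgroundPropagators, (3.71) p.404] -/
theorem bondCarrierEnd_smul_apply (c : ℂ) (L : (κ → S → 𝔸) →ₗ[ℂ] (κ → S → 𝔸)) (F : κ × S → 𝔸) (p : κ × S) :
    bondCarrierEnd (c • L) F p = c • bondCarrierEnd L F p := rfl

end Bond

/-! ## §3  The letters `F₁`, `F₂`, `D*D`, `DD*` in true units and the full `V₁(A)`, `V₂(A)` -/

section Letters

variable {𝔸 : Type*} [NormedRing 𝔸] [NormedAlgebra ℂ 𝔸] [CompleteSpace 𝔸] {S : Type} {κ : Type} [Fintype κ]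
variable (T : κ → Equiv.Perm S) (U : κ → S → 𝔸ˣ)

/-- **`F_{1,k}(A)` AS AN ℝ-LINEAR LETTER on the bond carrier**, true units: `A′ ↦ η⁻²·(F_{1,k}(A)A′)` — pv27's `F₁lin` (×η²) read on
bonds. [cite: Balaban1985BackgroundPropagators, (3.71)–(3.72) p.404–405] -/
def F₁Letter (η : ℝ) (A : κ → S → 𝔸) : Module.End ℝ (κ × S → 𝔸) := bondCarrierEnd ((((η : ℂ)⁻¹) ^ 2) • F₁lin T U η A)

/-- **`F_{2,k}(A)` AS AN ℝ-LINEAR LETTER on the bond carrier**, true units: `A′ ↦ η⁻²·(F_{2,k}(A)A′)` — pv27's `F₂lin` read on bonds.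
[cite: Balaban1985BackgroundPropagators, (3.75) + (3.72) p.405] -/
def F₂Letter (η : ℝ) (A : κ → S → 𝔸) : Module.End ℝ (κ × S → 𝔸) := bondCarrierEnd ((((η : ℂ)⁻¹) ^ 2) • F₂lin T U η A)

omit U in
/-- **`D*_VD_V` AS AN ℝ-LINEAR LETTER**, true units `c²·lapDD` (`c = η⁻¹`), for ANY configuration `V` in the slot of `U` (so that both
`V = U` and `V = U′U` are instances) — pv27's `lapDDlin` read on bonds. [cite: Balaban1985BackgroundPropagators, (3.71) p.404 + (3.9) p.392] -/
def lapDDLetter (c : ℂ) (V : κ → S → 𝔸ˣ) : Module.End ℝ (κ × S → 𝔸) := bondCarrierEnd ((c ^ 2) • lapDDlin T V)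

omit U in
/-- **`D_VD*_V` AS AN ℝ-LINEAR LETTER**, true units `c²·gradDiv`, for any configuration `V` — pv27's `gradDivlin` read on bonds.
[cite: Balaban1985BackgroundPropagators, (3.75) p.405 + (3.8) p.392] -/
def gradDivLetter (c : ℂ) (V : κ → S → 𝔸ˣ) : Module.End ℝ (κ × S → 𝔸) := bondCarrierEnd ((c ^ 2) • gradDivlin T V)

/-- Unfolding `F₁Letter` to pv27's function `F₁op`. [cite: Balaban1985BackgroundPropagators, (3.72) p.405] -/
theorem F₁Letter_apply (η : ℝ) (A : κ → S → 𝔸) (F : κ × S → 𝔸) (p : κ × S) :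
    F₁Letter T U η A F p = (((η : ℂ)⁻¹) ^ 2) • F₁op T U η A (fun k z => F (k, z)) p.1 p.2 := rfl

/-- Unfolding `F₂Letter` to pv27's function `F₂op`. [cite: Balaban1985BackgroundPropagators, (3.72) p.405] -/
theorem F₂Letter_apply (η : ℝ) (A : κ → S → 𝔸) (F : κ × S → 𝔸) (p : κ × S) :
    F₂Letter T U η A F p = (((η : ℂ)⁻¹) ^ 2) • F₂op T U η A (fun k z => F (k, z)) p.1 p.2 := rfl

omit [CompleteSpace 𝔸] U in
/-- Unfolding `lapDDLetter`. [cite: Balaban1985BackgroundPropagators, (3.71) p.404] -/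
theorem lapDDLetter_apply (c : ℂ) (V : κ → S → 𝔸ˣ) (F : κ × S → 𝔸) (p : κ × S) :
    lapDDLetter T c V F p = (c ^ 2) • lapDD T V (fun k z => F (k, z)) p.1 p.2 := rfl

omit [CompleteSpace 𝔸] U in
/-- Unfolding `gradDivLetter`. [cite: Balaban1985BackgroundPropagators, (3.75) p.405] -/
theorem gradDivLetter_apply (c : ℂ) (V : κ → S → 𝔸ˣ) (F : κ × S → 𝔸) (p : κ × S) :
    gradDivLetter T c V F p = (c ^ 2) • gradDiv T V (fun k z => F (k, z)) p.1 p.2 := rfl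

variable [DecidableEq κ]

/-- **THE FULL `V₁(A)` IN GRADIENT FORM**, true units: `V₁Op η A := V₁brkOp η⁻¹ A + F₁Letter η A` — the seven-term bracket in gradient
form (`B9Eq371GradLetters`) plus the higher-order letter. [cite: Balaban1985BackgroundPropagators, (3.71) p.404–405 + (3.73) p.405] -/
def V₁Op (η : ℝ) (A : κ → S → 𝔸) : Module.End ℝ (κ × S → 𝔸) :=
  V₁brkOp T U ((η : ℂ)⁻¹) A + F₁Letter T U η A

/-- **THE FULL `V₂(A)` IN GRADIENT FORM**, true units: `V₂Op η A := V₂brkOp η⁻¹ A + F₂Letter η A`.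
[cite: Balaban1985BackgroundPropagators, (3.75) p.405 + (3.73) p.405] -/
def V₂Op (η : ℝ) (A : κ → S → 𝔸) : Module.End ℝ (κ × S → 𝔸) :=
  V₂brkOp T U ((η : ℂ)⁻¹) A + F₂Letter T U η A

omit [CompleteSpace 𝔸] [Fintype κ] [DecidableEq κ] T U in
/-- The scalar bookkeeping `(η⁻¹)²·(η²·X) = X`. [folklore] -/
private theorem invsq_smul_sq_smul {η : ℝ} (hη : η ≠ 0) (X : 𝔸) :
    (((η : ℂ)⁻¹) ^ 2) • (((η : ℂ) ^ 2) • X) = X := by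
  have hη' : (η : ℂ) ≠ 0 := Complex.ofReal_ne_zero.mpr hη
  rw [smul_smul, show ((η : ℂ)⁻¹) ^ 2 * (η : ℂ) ^ 2 = 1 by field_simp, one_smul]

/-- **`V₁Op` IS pv27's `V₁(A)`** read on bonds in true units: `bondCarrierEnd (η⁻²·V₁lin η A) = V₁Op η A` (`V₁op = Σ_ν sBracket_ν + F₁op` by
pv27's definition, `B9Eq371GradLetters.sum_sBracket_eq` for the bracket). [cite: Balaban1985BackgroundPropagators, (3.71) p.404–405] -/
theorem bondCarrierEnd_V₁lin {η : ℝ} (hη : η ≠ 0) (A : κ → S → 𝔸) :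
    bondCarrierEnd ((((η : ℂ)⁻¹) ^ 2) • V₁lin T U η A) = V₁Op T U η A := by
  ext F p
  obtain ⟨μ, x⟩ := p
  show (((η : ℂ)⁻¹) ^ 2) • V₁op T U η A (fun k z => F (k, z)) μ x
    = V₁brkOp T U ((η : ℂ)⁻¹) A F (μ, x) + (((η : ℂ)⁻¹) ^ 2) • F₁op T U η A (fun k z => F (k, z)) μ x
  rw [V₁op, smul_add, sum_sBracket_eq T U hη, invsq_smul_sq_smul hη]

/-- **`V₂Op` IS pv27's `V₂(A)`** read on bonds in true units: `bondCarrierEnd (η⁻²·V₂lin η A) = V₂Op η A`.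
[cite: Balaban1985BackgroundPropagators, (3.75) p.405] -/
theorem bondCarrierEnd_V₂lin {η : ℝ} (hη : η ≠ 0) (A : κ → S → 𝔸) :
    bondCarrierEnd ((((η : ℂ)⁻¹) ^ 2) • V₂lin T U η A) = V₂Op T U η A := by
  ext F p
  obtain ⟨μ, x⟩ := p
  show (((η : ℂ)⁻¹) ^ 2) • V₂op T U η A (fun k z => F (k, z)) μ x
    = V₂brkOp T U ((η : ℂ)⁻¹) A F (μ, x) + (((η : ℂ)⁻¹) ^ 2) • F₂op T U η A (fun k z => F (k, z)) μ x
  rw [V₂op, smul_add, sum_sBracket₂_eq T U hη, invsq_smul_sq_smul hη]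

/-- `V₁Op` pointwise: `η²·(V₁Op η A)(A′)(μ, x) = V₁op T U η A A′ μ x` (pv27's function).
[cite: Balaban1985BackgroundPropagators, (3.71) p.404–405] -/
theorem V₁Op_apply {η : ℝ} (hη : η ≠ 0) (A : κ → S → 𝔸) (F : κ × S → 𝔸) (μ : κ) (x : S) :
    ((η : ℂ) ^ 2) • V₁Op T U η A F (μ, x) = V₁op T U η A (fun k z => F (k, z)) μ x := by
  have hη' : (η : ℂ) ≠ 0 := Complex.ofReal_ne_zero.mpr hη
  rw [← bondCarrierEnd_V₁lin T U hη, bondCarrierEnd_smul_apply, smul_smul, show (η : ℂ) ^ 2 * ((η : ℂ)⁻¹) ^ 2 = 1 by field_simp,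
    one_smul]
  rfl

/-- `V₂Op` pointwise: `η²·(V₂Op η A)(A′)(μ, x) = V₂op T U η A A′ μ x`. [cite: Balaban1985BackgroundPropagators, (3.75) p.405] -/
theorem V₂Op_apply {η : ℝ} (hη : η ≠ 0) (A : κ → S → 𝔸) (F : κ × S → 𝔸) (μ : κ) (x : S) :
    ((η : ℂ) ^ 2) • V₂Op T U η A F (μ, x) = V₂op T U η A (fun k z => F (k, z)) μ x := by
  have hη' : (η : ℂ) ≠ 0 := Complex.ofReal_ne_zero.mpr hη
  rw [← bondCarrierEnd_V₂lin T U hη, bondCarrierEnd_smul_apply, smul_smul, show (η : ℂ) ^ 2 * ((η : ℂ)⁻¹) ^ 2 = 1 by field_simp,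
    one_smul]
  rfl

end Letters

/-! ## §4  (3.71) and (3.75) as equalities of ℝ-linear letters — the `h371` shape of the G-side devices -/

section Identities

variable {𝔸 : Type*} [NormedRing 𝔸] [NormedAlgebra ℂ 𝔸] [CompleteSpace 𝔸] {S : Type} {κ : Type} [Fintype κ] [DecidableEq κ]
variable (T : κ → Equiv.Perm S) (U : κ → S → 𝔸ˣ)

/-- **(3.71) AS AN EQUALITY OF LETTERS** in true units on the bond carrier: `D*D_{U′U} = D*D_U − V₁(A)` —
`lapDDLetter η⁻¹ (prodCfg U η A) = lapDDLetter η⁻¹ U − V₁Op η A` (pv27's `End_ℂ` identity `B9Eq372Operator.lapDDlin_prodCfg` read on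
bonds, `bondCarrierEnd_V₁lin`). [cite: Balaban1985BackgroundPropagators, (3.71) p.404–405] -/
theorem lapDDLetter_prodCfg {η : ℝ} (hη : η ≠ 0) (A : κ → S → 𝔸) :
    lapDDLetter T ((η : ℂ)⁻¹) (prodCfg U η A) = lapDDLetter T ((η : ℂ)⁻¹) U - V₁Op T U η A := by
  unfold lapDDLetter
  rw [lapDDlin_prodCfg, smul_sub, bondCarrierEnd_sub, bondCarrierEnd_V₁lin T U hη]

/-- **(3.75) AS AN EQUALITY OF LETTERS**: `DD*_{U′U} = DD*_U − V₂(A)` — `gradDivLetter η⁻¹ (prodCfg U η A) = gradDivLetter η⁻¹ U −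
V₂Op η A` (pv27's `gradDivlin_prodCfg` read on bonds). [cite: Balaban1985BackgroundPropagators, (3.75) p.405] -/
theorem gradDivLetter_prodCfg {η : ℝ} (hη : η ≠ 0) (A : κ → S → 𝔸) :
    gradDivLetter T ((η : ℂ)⁻¹) (prodCfg U η A) = gradDivLetter T ((η : ℂ)⁻¹) U - V₂Op T U η A := by
  unfold gradDivLetter
  rw [gradDivlin_prodCfg, smul_sub, bondCarrierEnd_sub, bondCarrierEnd_V₂lin T U hη]

variable {ι : Type} [Fintype ι] (b : Module.Basis ι ℝ 𝔸)

/-- **THE `h371` HYPOTHESIS OF THE G-SIDE DEVICES, AS A THEOREM**: after real coordinates, `conj b (D*D_{U′U}) = conj b (D*D_U) −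
conj b (V₁(A))` — the shape `DsD′ = DsD − V₁` of `B9Ineq386CommSum.thm34_G_entries13_opForm_of_comm_sum` with `DsD := conj b
(lapDDLetter η⁻¹ U)`, `DsD′ := conj b (lapDDLetter η⁻¹ (U′U))`, `V₁ := conj b (V₁Op η A)`.
[cite: Balaban1985BackgroundPropagators, (3.71) p.404–405 + (3.82) p.407; Balaban1984PropagatorsII, (2.52) p.232] -/
theorem conj_lapDDLetter_prodCfg {η : ℝ} (hη : η ≠ 0) (A : κ → S → 𝔸) :
    conj b (lapDDLetter T ((η : ℂ)⁻¹) (prodCfg U η A)) = conj b (lapDDLetter T ((η : ℂ)⁻¹) U) - conj b (V₁Op T U η A) := by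
  rw [lapDDLetter_prodCfg T U hη, conj_sub]

/-- The `DD*` twin: `conj b (DD*_{U′U}) = conj b (DD*_U) − conj b (V₂(A))`.
[cite: Balaban1985BackgroundPropagators, (3.75) p.405 + (3.82) p.407; Balaban1984PropagatorsII, (2.52) p.232] -/
theorem conj_gradDivLetter_prodCfg {η : ℝ} (hη : η ≠ 0) (A : κ → S → 𝔸) :
    conj b (gradDivLetter T ((η : ℂ)⁻¹) (prodCfg U η A))
      = conj b (gradDivLetter T ((η : ℂ)⁻¹) U) - conj b (V₂Op T U η A) := by
  rw [gradDivLetter_prodCfg T U hη, conj_sub]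

/-- **THE FULL `V₁(A)` IN THE DEVICES' GRADIENT FORM** after real coordinates: `conj b (V₁Op η A) = V0 + Σ_{k∈κ⊕κ} V1_k·D_k` with
`V0 := conj b (zeroLetter η⁻¹ A + F₁Letter η A)`, `V1_k := conj b (V1Letter A k)`, `D_k := conj b (∇_k)` (`diffLetter` on the bond
carrier) — the `hV₃`-shape `V₃ = V0 + Σ_{k∈s} V1 k * D k` of `B9Ineq386CommSum.thm34_G_entries13_opForm_of_comm_sum` for the
`V₁`-third of (3.82). [cite: Balaban1985BackgroundPropagators, (3.71)–(3.73) p.404–405 + (3.82) p.407] -/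
theorem conj_V₁Op_eq_gradForm (η : ℝ) (A : κ → S → 𝔸) :
    conj b (V₁Op T U η A)
      = conj b (zeroLetter T U ((η : ℂ)⁻¹) A + F₁Letter T U η A)
        + ∑ k ∈ Finset.univ, conj b (V1Letter T U A k) * conj b (diffLetter (bT T) (bU U) ((η : ℂ)⁻¹) k) := by
  rw [V₁Op, conj_add, conj_add, conj_V₁brkOp_eq_gradForm]
  abel

/-- The `V₂` twin: `conj b (V₂Op η A) = conj b (zeroLetter₂ η⁻¹ A + F₂Letter η A) + Σ_k conj b (V1Letter₂ A k)·conj b (∇_k)`.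
[cite: Balaban1985BackgroundPropagators, (3.75) + (3.72)–(3.73) p.405 + (3.82) p.407] -/
theorem conj_V₂Op_eq_gradForm (η : ℝ) (A : κ → S → 𝔸) :
    conj b (V₂Op T U η A)
      = conj b (zeroLetter₂ T U ((η : ℂ)⁻¹) A + F₂Letter T U η A)
        + ∑ k ∈ Finset.univ, conj b (V1Letter₂ T U A k) * conj b (diffLetter (bT T) (bU U) ((η : ℂ)⁻¹) k) := by
  rw [V₂Op, conj_add, conj_add, conj_V₂brkOp_eq_gradForm]
  abel

end Identities

/-! ## §5  The (3.72) size as a zeroth-order block majorant -/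

section Majorants

variable {𝔸 : Type*} [NormedRing 𝔸] [NormedAlgebra ℂ 𝔸] [CompleteSpace 𝔸] {ι : Type} [Fintype ι]
variable (b : Module.Basis ι ℝ 𝔸) {S : Type} {κ : Type} [Fintype κ]
variable (T : κ → Equiv.Perm S) (U : κ → S → 𝔸ˣ)
variable {g : B9.Geometry} [Fintype g.Site] {Rr : ℝ} {H : Prop}

omit [Fintype ι] b [Fintype κ] T U [Fintype g.Site] [CompleteSpace 𝔸] in
/-- `‖(η⁻¹)²·X‖ = (η²)⁻¹‖X‖` for `η > 0`. [folklore] -/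
private theorem norm_invsq_smul {η : ℝ} (hη : 0 < η) (X : 𝔸) :
    ‖(((η : ℂ)⁻¹) ^ 2) • X‖ = (η ^ 2)⁻¹ * ‖X‖ := by
  rw [norm_smul, norm_pow, norm_inv, Complex.norm_real, Real.norm_eq_abs, abs_of_pos hη, inv_pow]

/-- THE ARITHMETIC OF (3.72) IN TRUE UNITS: pv27's local bound `X ≦ m·(kρ⁴s²e^{2s}(3 + 2s + s²e^{2s})·B)` at `s = ηρ²a` with
`a = α₁(Lʲη)⁻¹`, `η·a ≦ 1/4` (so `s ≦ ρ²/4`) and `m ≦ m′` gives `η⁻²X ≦ m′kρ⁸·growth(ρ²/4)·a²·B` — the size `O(1)|A|²|A′|`.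
[cite: Balaban1985BackgroundPropagators, (3.72) p.405 + (3.37) p.396] -/
private theorem remainder_bound {η ρ a B k m m' X : ℝ} (hη : 0 < η) (ha : 0 ≤ a) (hk : 0 ≤ k) (hB : 0 ≤ B)
    (hm : m ≤ m') (hm' : 0 ≤ m') (hsmall : η * a ≤ 1 / 4)
    (hX : X ≤ m * (k * ρ ^ 4 * (η * ρ ^ 2 * a) ^ 2 * Real.exp (2 * (η * ρ ^ 2 * a))
          * (3 + 2 * (η * ρ ^ 2 * a) + (η * ρ ^ 2 * a) ^ 2 * Real.exp (2 * (η * ρ ^ 2 * a))) * B)) :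
    (η ^ 2)⁻¹ * X ≤ m' * k * ρ ^ 8 * growth (ρ ^ 2 / 4) * a ^ 2 * B := by
  have hη0 : η ≠ 0 := hη.ne'
  have ht0 : 0 ≤ η * ρ ^ 2 * a := by positivity
  have ht1 : η * ρ ^ 2 * a ≤ ρ ^ 2 / 4 := by nlinarith [sq_nonneg ρ]
  have hg : Real.exp (2 * (η * ρ ^ 2 * a)) * (3 + 2 * (η * ρ ^ 2 * a) + (η * ρ ^ 2 * a) ^ 2 * Real.exp (2 * (η * ρ ^ 2 * a)))
      ≤ growth (ρ ^ 2 / 4) := growth_mono ht0 ht1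
  have hE0 : 0 ≤ Real.exp (2 * (η * ρ ^ 2 * a)) *
      (3 + 2 * (η * ρ ^ 2 * a) + (η * ρ ^ 2 * a) ^ 2 * Real.exp (2 * (η * ρ ^ 2 * a))) := by positivity
  have h0 : 0 ≤ k * ρ ^ 4 * (η * ρ ^ 2 * a) ^ 2 * Real.exp (2 * (η * ρ ^ 2 * a))
      * (3 + 2 * (η * ρ ^ 2 * a) + (η * ρ ^ 2 * a) ^ 2 * Real.exp (2 * (η * ρ ^ 2 * a))) * B := by positivity
  have h1 := hX.trans (mul_le_mul_of_nonneg_right hm h0)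
  have hsq : (η ^ 2)⁻¹ * (η * ρ ^ 2 * a) ^ 2 = ρ ^ 4 * a ^ 2 := by field_simp
  have hc : 0 ≤ m' * k * ρ ^ 8 * a ^ 2 * B := by positivity
  calc (η ^ 2)⁻¹ * X
      ≤ (η ^ 2)⁻¹ * (m' * (k * ρ ^ 4 * (η * ρ ^ 2 * a) ^ 2 * Real.exp (2 * (η * ρ ^ 2 * a))
          * (3 + 2 * (η * ρ ^ 2 * a) + (η * ρ ^ 2 * a) ^ 2 * Real.exp (2 * (η * ρ ^ 2 * a))) * B)) :=
        mul_le_mul_of_nonneg_left h1 (by positivity)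
    _ = m' * k * ρ ^ 4 * ((η ^ 2)⁻¹ * (η * ρ ^ 2 * a) ^ 2) * (Real.exp (2 * (η * ρ ^ 2 * a))
          * (3 + 2 * (η * ρ ^ 2 * a) + (η * ρ ^ 2 * a) ^ 2 * Real.exp (2 * (η * ρ ^ 2 * a)))) * B := by ring
    _ = (m' * k * ρ ^ 8 * a ^ 2 * B) * (Real.exp (2 * (η * ρ ^ 2 * a))
          * (3 + 2 * (η * ρ ^ 2 * a) + (η * ρ ^ 2 * a) ^ 2 * Real.exp (2 * (η * ρ ^ 2 * a)))) := by rw [hsq]; ring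
    _ ≤ (m' * k * ρ ^ 8 * a ^ 2 * B) * growth (ρ ^ 2 / 4) := mul_le_mul_of_nonneg_left hg hc
    _ = m' * k * ρ ^ 8 * growth (ρ ^ 2 / 4) * a ^ 2 * B := by ring

/-- **(3.72) FOR `F_{1,k}(A)` AS A ZEROTH-ORDER BLOCK MAJORANT**: under (3.37) read on the bonds of `st(b)` at the scale of the block of
`b` (`‖A(b′)‖ ≦ α₁(Lʲη)⁻¹` for `b′ ∈ stBonds(b)`, `b ∈ B(y)`, `y ∈ Λ_j` — «with the same norms |A|, |A′| determined by the set st(b)»),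
transports `1 ≦ ρ`, `‖U‖, ‖U⁻¹‖ ≦ ρ`, the smallness `η·α₁(Lʲη)⁻¹ ≦ 1/4` and the stencil geometry `d(y(b), y(b′)) ≦ d₀` for `b′ ∈ st(b)`
(and `d(y,y) ≦ d₀`): `conj b (F₁Letter η A) ≺ (8d·ρ⁸·growth(ρ²/4)·α₁·M₂(Σ‖b_i‖)e^{δd₀})·α₁·(Lʲη)⁻²·e^{−δd(y,y′)}` (`d = |κ|`) — the size
«O(1)α₁²(Lʲη)⁻²|A′|» of a local, bounded operator in the block calculus (pv27's `norm_F₁op_le_st` + gen 8's seam lemma; `|κ| − 1 ≦ |κ|`).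
[cite: Balaban1985BackgroundPropagators, (3.72) p.405 + (3.37) p.396; Balaban1984PropagatorsII, (2.51)–(2.52) p.232] -/
theorem hasMajorant_F₁Letter (blk : S → g.Site) {η : ℝ} (hη : 0 < η) (A : κ → S → 𝔸) (ρ d₀ δ M₂ α₁ : ℝ)
    (hα₁ : 0 ≤ α₁) (hδ : 0 ≤ δ) (hM₂ : 0 ≤ M₂) (hrepr : ∀ (v : 𝔸) (i : ι), |b.repr v i| ≤ M₂ * ‖v‖)
    (hlen : ∀ y : g.Site, 0 < g.len y) (hsmall : ∀ y : g.Site, η * (α₁ * (g.len y)⁻¹) ≤ 1 / 4) (hρ1 : 1 ≤ ρ)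
    (hρ : ∀ μ x, ‖((U μ x : 𝔸ˣ) : 𝔸)‖ ≤ ρ ∧ ‖(((U μ x)⁻¹ : 𝔸ˣ) : 𝔸)‖ ≤ ρ)
    (hAst : ∀ μ x k z, (k, z) ∈ stBonds T μ x → ‖A k z‖ ≤ α₁ * (g.len (blk x))⁻¹)
    (hd₀st : ∀ μ x (q : κ × S), q ∈ stBonds T μ x → g.dist (blk x) (blk q.2) ≤ d₀)
    (hd₀0 : ∀ y : g.Site, g.dist y y ≤ d₀) :
    HasMajorant (g := toB6 g Rr H) (fun q : (κ × S) × ι => blk q.1.2) (conj b (F₁Letter T U η A))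
      (fun y y' => (8 * Fintype.card κ * ρ ^ 8 * growth (ρ ^ 2 / 4) * α₁ * M₂ * (∑ i, ‖b i‖) * Real.exp (δ * d₀)) * α₁ *
        (g.len y ^ 2)⁻¹ * Real.exp (-(δ * g.dist y y'))) := by
  have hρ0 : 0 ≤ ρ := zero_le_one.trans hρ1
  have hG : 0 ≤ growth (ρ ^ 2 / 4) := growth_nonneg (by positivity)
  have hc0 : ∀ y : g.Site, 0 ≤ 8 * Fintype.card κ * ρ ^ 8 * growth (ρ ^ 2 / 4) * α₁ * α₁ * (g.len y ^ 2)⁻¹ := fun y => by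
    positivity
  refine hasMajorant_mono (g := toB6 g Rr H) _
    (hasMajorant_conj_of_local (Rr := Rr) (H := H) b (fun p : κ × S => blk p.2) (fun p q => q = p ∨ q ∈ stBonds T p.1 p.2)
      (fun y => 8 * Fintype.card κ * ρ ^ 8 * growth (ρ ^ 2 / 4) * α₁ * α₁ * (g.len y ^ 2)⁻¹) d₀ δ M₂ hc0 hδ hM₂ hrepr
      ?_ (F₁Letter T U η A) ?_)
    fun y y' => le_of_eq (by ring)
  · rintro p q (rfl | h)
    · exact hd₀0 _
    · exact hd₀st p.1 p.2 q h
  · intro F p B hB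
    have hB0 : 0 ≤ B := (norm_nonneg _).trans (hB p (Or.inl rfl))
    have hl : 0 < g.len (blk p.2) := hlen _
    have ha : 0 ≤ α₁ * (g.len (blk p.2))⁻¹ := by positivity
    have hκ : ((Fintype.card κ : ℝ) - 1) ≤ Fintype.card κ := by linarith
    -- pv27's local (3.72) bound with `|A| = α₁ℓ⁻¹` on `st(b)` and `|A′| = B`
    have h372 := norm_F₁op_le_st T U hη.le hρ1 (fun k z => (hρ k z).1) (fun k z => (hρ k z).2) A (fun k z => F (k, z))
      (μ := p.1) (x := p.2) (a := α₁ * (g.len (blk p.2))⁻¹) (a' := B) (fun k z h => hAst p.1 p.2 k z h)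
      (fun k z h => hB (k, z) (Or.inr h))
    rw [F₁Letter_apply, norm_invsq_smul hη]
    calc (η ^ 2)⁻¹ * ‖F₁op T U η A (fun k z => F (k, z)) p.1 p.2‖
        ≤ Fintype.card κ * 8 * ρ ^ 8 * growth (ρ ^ 2 / 4) * (α₁ * (g.len (blk p.2))⁻¹) ^ 2 * B :=
          remainder_bound hη ha (by norm_num) hB0 hκ (Nat.cast_nonneg _) (hsmall _) h372
      _ = 8 * Fintype.card κ * ρ ^ 8 * growth (ρ ^ 2 / 4) * α₁ * α₁ * (g.len (blk p.2) ^ 2)⁻¹ * B := by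
          rw [mul_pow, inv_pow]; ring

/-- **(3.72) FOR `F_{2,k}(A)` AS A ZEROTH-ORDER BLOCK MAJORANT** («the operators F_{2,k}(A), V₂(A) satisfy (3.72), (3.73)
correspondingly»): under (3.37) read on pv27's (3.75)-stencil `locBondsA(b)` at the scale of the block of `b`, transports, the
smallness `η·α₁(Lʲη)⁻¹ ≦ 1/4` and the stencil geometry of `locBondsA′(b)`: `conj b (F₂Letter η A) ≺ (4d·ρ⁸·growth(ρ²/4)·α₁·
M₂(Σ‖b_i‖)e^{δd₀})·α₁·(Lʲη)⁻²·e^{−δd(y,y′)}` (pv27's `norm_F₂op_le_loc` + gen 8's seam lemma).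
[cite: Balaban1985BackgroundPropagators, (3.75) + (3.72) p.405 + (3.37) p.396; Balaban1984PropagatorsII, (2.51)–(2.52) p.232] -/
theorem hasMajorant_F₂Letter (blk : S → g.Site) {η : ℝ} (hη : 0 < η) (A : κ → S → 𝔸) (ρ d₀ δ M₂ α₁ : ℝ)
    (hα₁ : 0 ≤ α₁) (hδ : 0 ≤ δ) (hM₂ : 0 ≤ M₂) (hrepr : ∀ (v : 𝔸) (i : ι), |b.repr v i| ≤ M₂ * ‖v‖)
    (hlen : ∀ y : g.Site, 0 < g.len y) (hsmall : ∀ y : g.Site, η * (α₁ * (g.len y)⁻¹) ≤ 1 / 4) (hρ1 : 1 ≤ ρ)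
    (hρ : ∀ μ x, ‖((U μ x : 𝔸ˣ) : 𝔸)‖ ≤ ρ ∧ ‖(((U μ x)⁻¹ : 𝔸ˣ) : 𝔸)‖ ≤ ρ)
    (hAloc : ∀ μ x k z, (k, z) ∈ locBondsA T μ x → ‖A k z‖ ≤ α₁ * (g.len (blk x))⁻¹)
    (hd₀loc : ∀ μ x (q : κ × S), q ∈ locBondsA' T μ x → g.dist (blk x) (blk q.2) ≤ d₀)
    (hd₀0 : ∀ y : g.Site, g.dist y y ≤ d₀) :
    HasMajorant (g := toB6 g Rr H) (fun q : (κ × S) × ι => blk q.1.2) (conj b (F₂Letter T U η A))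
      (fun y y' => (4 * Fintype.card κ * ρ ^ 8 * growth (ρ ^ 2 / 4) * α₁ * M₂ * (∑ i, ‖b i‖) * Real.exp (δ * d₀)) * α₁ *
        (g.len y ^ 2)⁻¹ * Real.exp (-(δ * g.dist y y'))) := by
  have hρ0 : 0 ≤ ρ := zero_le_one.trans hρ1
  have hG : 0 ≤ growth (ρ ^ 2 / 4) := growth_nonneg (by positivity)
  have hc0 : ∀ y : g.Site, 0 ≤ 4 * Fintype.card κ * ρ ^ 8 * growth (ρ ^ 2 / 4) * α₁ * α₁ * (g.len y ^ 2)⁻¹ := fun y => by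
    positivity
  refine hasMajorant_mono (g := toB6 g Rr H) _
    (hasMajorant_conj_of_local (Rr := Rr) (H := H) b (fun p : κ × S => blk p.2) (fun p q => q = p ∨ q ∈ locBondsA' T p.1 p.2)
      (fun y => 4 * Fintype.card κ * ρ ^ 8 * growth (ρ ^ 2 / 4) * α₁ * α₁ * (g.len y ^ 2)⁻¹) d₀ δ M₂ hc0 hδ hM₂ hrepr
      ?_ (F₂Letter T U η A) ?_)
    fun y y' => le_of_eq (by ring)
  · rintro p q (rfl | h)
    · exact hd₀0 _
    · exact hd₀loc p.1 p.2 q h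
  · intro F p B hB
    have hB0 : 0 ≤ B := (norm_nonneg _).trans (hB p (Or.inl rfl))
    have hl : 0 < g.len (blk p.2) := hlen _
    have ha : 0 ≤ α₁ * (g.len (blk p.2))⁻¹ := by positivity
    have h372 := norm_F₂op_le_loc T U hη.le hρ1 ha hB0 (fun k z => (hρ k z).1) (fun k z => (hρ k z).2) A
      (fun k z => F (k, z)) p.1 p.2 (fun k z h => hAloc p.1 p.2 k z h) (fun k z h => hB (k, z) (Or.inr h))
    rw [F₂Letter_apply, norm_invsq_smul hη]
    calc (η ^ 2)⁻¹ * ‖F₂op T U η A (fun k z => F (k, z)) p.1 p.2‖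
        ≤ Fintype.card κ * 4 * ρ ^ 8 * growth (ρ ^ 2 / 4) * (α₁ * (g.len (blk p.2))⁻¹) ^ 2 * B :=
          remainder_bound hη ha (by norm_num) hB0 le_rfl (Nat.cast_nonneg _) (hsmall _) h372
      _ = 4 * Fintype.card κ * ρ ^ 8 * growth (ρ ^ 2 / 4) * α₁ * α₁ * (g.len (blk p.2) ^ 2)⁻¹ * B := by
          rw [mul_pow, inv_pow]; ring

/-- **THE ZEROTH-ORDER PART OF THE FULL `V₁(A)` HAS THE (3.73) SIZE**: `conj b (zeroLetter η⁻¹ A + F₁Letter η A) ≺ (c_br + c_F)·α₁(Lʲη)⁻²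
e^{−δd}` — the bracket's `V⁰` (`B9Eq371GradLetters.hasMajorant_zeroLetter`) plus the remainder, i.e. with `conj_V₁Op_eq_gradForm` the
`hV0` input of `B9Ineq386CommSum.ineq385_op_sum` for the `V₁`-third of the concrete `V₃` of (3.82).
[cite: Balaban1985BackgroundPropagators, (3.72)–(3.73) p.405 + (3.82) p.407; Balaban1984PropagatorsII, (2.51)–(2.52) p.232] -/
theorem hasMajorant_V₁Op_zero [DecidableEq κ] (blk : S → g.Site) {η : ℝ} (hη : 0 < η) (A : κ → S → 𝔸) (ρ d₀ δ M₂ α₁ : ℝ)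
    (hα₁ : 0 ≤ α₁) (hδ : 0 ≤ δ) (hM₂ : 0 ≤ M₂) (hrepr : ∀ (v : 𝔸) (i : ι), |b.repr v i| ≤ M₂ * ‖v‖)
    (hlen : ∀ y : g.Site, 0 < g.len y) (hsmall : ∀ y : g.Site, η * (α₁ * (g.len y)⁻¹) ≤ 1 / 4) (hρ1 : 1 ≤ ρ)
    (hρ : ∀ μ x, ‖((U μ x : 𝔸ˣ) : 𝔸)‖ ≤ ρ ∧ ‖(((U μ x)⁻¹ : 𝔸ˣ) : 𝔸)‖ ≤ ρ)
    (h337 : ∀ ν k x, ‖((η : ℂ)⁻¹) • covDstar T U ν (A k) x‖ ≤ α₁ * (g.len (blk x) ^ 2)⁻¹)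
    (hAst : ∀ μ x k z, (k, z) ∈ stBonds T μ x → ‖A k z‖ ≤ α₁ * (g.len (blk x))⁻¹)
    (hd₀ : ∀ μ x, g.dist (blk x) (blk ((T μ).symm x)) ≤ d₀)
    (hd₀st : ∀ μ x (q : κ × S), q ∈ stBonds T μ x → g.dist (blk x) (blk q.2) ≤ d₀)
    (hd₀0 : ∀ y : g.Site, g.dist y y ≤ d₀) :
    HasMajorant (g := toB6 g Rr H) (fun q : (κ × S) × ι => blk q.1.2)
      (conj b (B9Eq371GradLetters.zeroLetter T U ((η : ℂ)⁻¹) A + F₁Letter T U η A))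
      (fun y y' => ((2 * (1 + ρ ^ 2) * Fintype.card κ + 8 * Fintype.card κ * ρ ^ 8 * growth (ρ ^ 2 / 4) * α₁) * M₂ *
        (∑ i, ‖b i‖) * Real.exp (δ * d₀)) * α₁ * (g.len y ^ 2)⁻¹ * Real.exp (-(δ * g.dist y y'))) := by
  rw [conj_add]
  refine hasMajorant_mono (g := toB6 g Rr H) _
    (B6RandomWalk.hasMajorant_add (g := toB6 g Rr H) _
      (B9Eq371GradLetters.hasMajorant_zeroLetter (Rr := Rr) (H := H) b T U blk ((η : ℂ)⁻¹) A ρ d₀ δ M₂ α₁ hα₁ hδ hM₂ hrepr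
        h337 hρ hd₀ hd₀0)
      (hasMajorant_F₁Letter (Rr := Rr) (H := H) b T U blk hη A ρ d₀ δ M₂ α₁ hα₁ hδ hM₂ hrepr hlen hsmall hρ1 hρ hAst hd₀st
        hd₀0))
    fun y y' => le_of_eq (by ring)

end Majorants


end Literature.MathematicalPhysics.QuantumFieldTheory.Balaban1983to89.B9Eq372RemLetters
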